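import Literature.NumberTheory.EllipticCurves.FineSelmerTorsionCoefficientsFiniteProofs
import Literature.NumberTheory.EllipticCurves.KatoFineSelmerDualRelaxedAtInfinity
import HarnessLib

/-!
# PERFECT DESCENT §3(v), BOTH HALVES, in the RELAXED-at-`∞` currency — cyclotomic `ℤ_p`-extension of ANY number
# field, ANY prime `p` (so `p = 2`): `Sel₀^{rel ∞}(K_∞, E[p^∞])[p]` finite ⟺ `Sel₀^{rel ∞}(K_∞, E[p])` finite

Cell `bsd-f1-sign2`, WIDTH-5 attach seat `bsd-line-att-p5` (gen 5) on line `birth` of crux C2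
stmt-BirchSwinnertonDyer-22298 `MainConjectureOfRankZeroBSDAtTwo`; sequel of att-p5 g4's `…FineRoadTwoTorsionCoefficients`
(the NECESSITY half of the lead's PERFECT-DESCENT.md §3 (v) over `ℚ_∞`). A `--supports 22298 --as helper` file; its `(ℚ, 2)`
corollaries are the sibling `…FineRoadRelaxedCoefficientsRatTwo`. HONEST FRAMING: THEOREMS ONLY — no definition, no named
fact, no `sorry`; nothing here is specific to the seed cell; BSD is NOT proved by any of this.

WHAT AND WHY. PERFECT-DESCENT.md §3 (v) passes from `E[2]`- to `E[2^∞]`-coefficients over `ℚ_∞` («`Sel₀(ℚ_∞, N) ↪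
Sel₀(ℚ_∞, E[2^∞])[2]` with cokernel `↪ ⊕_{v ∈ Σ(ℚ_∞)} E(ℚ_{∞,v})[2^∞]/2` — finitely many places»). The Literature holds this
passage for the STRICT fine Selmer group and `p` ODD (`FineSelmerCoefficientMap.finite_fineSelmerInfty_pTorsion_of_finite_torsion`,
the Lim–Sujatha 2018 §3 discharge: finitely many places of `K_∞` above each finite `v` since `κ(D_v)` is closed and
`⊇ p^c ℤ_p` — `forall_resOfLe_conjH1_eq_zero_of_reps`; vanishing local kernels at good `v ∤ p` —
`CyclotomicLocalTorsionDivisibleProofs`), where `p ≠ 2` serves ONE purpose: to kill the ARCHIMEDEAN local kernels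
`ker (H¹(K_{∞,w}, E[p]) → H¹(K_{∞,w}, E[p^∞])) = E(K_{∞,w})[p^∞]/p` at the infinitely many real places of `K_∞`. At `p = 2`
over `ℚ` these are `E(ℝ)[2^∞]/2 ≅ ℤ/2^{[Δ_E > 0]}` at each of the `2ⁿ` real places of `ℚ_n`: in the STRICT currency the note's
«finitely many places» fails for `Δ_E > 0` (Greenberg's archimedean `(Λ/2)^{[Δ_E>0]}`, LNM 1716 Lemma 4.6, seen with
`E[2]`-coefficients). The RELAXED-at-`∞` groups of -ty's p600292 (`fineSelmerInftyRelaxedInf`: no archimedean clause) do not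
see them, and there the passage holds for EVERY `p`:

* §1 `mem_fineSelmerInftyRelaxedInf_iff_resOfLe`; `resH1Hom_id_mem_fineSelmerInftyRelaxedInf` (functoriality in the
  coefficients); **`finite_fineSelmerInftyRelaxedInf_torsion_of_finite_pTorsion`** (⟹: any `K`, `p`, `κ`).
* §2 **`finite_fineSelmerInftyRelaxedInf_pTorsion_of_finite_torsion`** (⟸: cyclotomic `κ`, ANY `p` — the Literature assembly
  with the archimedean branch absent); **`finite_fineSelmerInftyRelaxedInf_pTorsion_iff`**; and the STRICT form under
  «every archimedean condition on `H¹(K_∞, E[p])` is vacuous» (`finite_fineSelmerInfty_pTorsion_of_finite_torsion_of_infKer_eq_top`: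
  recovers the Literature's odd `p`; covers `(ℚ, 2, Δ_E < 0)`, sibling file; NOT `(ℚ, 2, Δ_E > 0)`).

References: M. F. Lim, R. Sujatha, J. Number Theory 187 (2018) §3 (proof of Prop. 3.2); R. Greenberg, LNM 1716 (1999) §3
(Lemmas 3.1–3.3), §4 Lemma 4.6 and pp. 106–107; R. Greenberg, Adv. Stud. Pure Math. 17 (1989) p. 98; J.-P. Serre, *Galois
Cohomology* I §2.4–2.5; the lead's PERFECT-DESCENT.md §3 (v) (crux workfile, cell bsd-f1-sign2).
-/

set_option autoImplicit false
-- the Theorems namespace of this sub repeats the summit name by design (D-0017 nested layout)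
set_option linter.dupNamespace false

noncomputable section

open scoped Classical

namespace Summit.BirchSwinnertonDyer.BirchSwinnertonDyer.Theorems.AlignedTransportAtTwoFineRoad.RelaxedCoefficients

open WeierstrassCurve NumberField IsDedekindDomain Field Literature.NumberTheory.EllipticCurves
  Literature.NumberTheory.EllipticCurves.GreenbergSelmer Literature.NumberTheory.GaloisRepresentations
  Literature.NumberTheory.EllipticCurves.FineSelmerCoefficientMap

universe u

/-! ## §1 The relaxed-at-`∞` fine conditions as vanishing of restrictions; functoriality; the easy half -/

section Criterion

variable {K : Type u} [Field K] [NumberField K]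
variable {M : Type u} [AddCommGroup M] [DistribMulAction (absoluteGaloisGroup K) M]
  [TopologicalSpace M] [DiscreteTopology M]
variable {M' : Type u} [AddCommGroup M'] [DistribMulAction (absoluteGaloisGroup K) M']
  [TopologicalSpace M'] [DiscreteTopology M']
variable {p : ℕ} [Fact p.Prime] (κ : ZpExtension K p)

/-- **Membership in `Sel₀^{rel ∞}(K_∞, M)` as the vanishing of restrictions at the FINITE places only**: `c` lies in
the relaxed-at-`∞` fine Selmer group iff for every finite place `v` of `K` and every `σ ∈ Γ_K` the conjugate class
`conj_σ c` restricts to zero on `H ⊓ D_v` (`H = Gal(K̄/K_∞)`); the fine data impose "locally trivial" at `v ∣ p` as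
at `v ∤ p` (`mem_strictKer_fineLocalDatum_iff`), and there is NO archimedean clause.
[cite: Greenberg1989, §1 p. 98] [cite: GreenbergLNM1716, §4, before Lemma 4.6 (PDF p. 106)] -/
theorem mem_fineSelmerInftyRelaxedInf_iff_resOfLe (c : subgroupH1 κ.kerSubgroup M) :
    c ∈ fineSelmerInftyRelaxedInf M κ ↔
      ∀ (v : HeightOneSpectrum (𝓞 K)) (σ : absoluteGaloisGroup K),
        resOfLe M (inf_le_left : κ.kerSubgroup ⊓ decomp v ≤ κ.kerSubgroup)
          (conjH1 κ.kerSubgroup M σ c) = 0 := by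
  rw [fineSelmerInftyRelaxedInf_eq, mem_strictSelmerGroupOverRelaxedInf_iff]
  constructor
  · rintro ⟨h1, h3⟩ v σ
    by_cases hv : ((p : ℕ) : 𝓞 K) ∈ v.asIdeal
    · exact (mem_strictKer_fineLocalDatum_iff _ v _).1 (h3 v hv σ)
    · exact h1 v hv σ
  · intro h1
    exact ⟨fun v _ σ ↦ h1 v σ, fun v _ σ ↦ (mem_strictKer_fineLocalDatum_iff _ v _).2 (h1 v σ)⟩

/-- **A `Γ_K`-equivariant map of coefficients maps `Sel₀^{rel ∞}(K_∞, M)` into `Sel₀^{rel ∞}(K_∞, M′)`** (`ψ_*`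
commutes with conjugation and restriction, `conjH1_comp_resH1Hom_id`, `resOfLe_comp_resH1Hom_id`).
[cite: LimSujatha2018, §3 (functoriality of `R_S(·/𝓛)`)] -/
theorem resH1Hom_id_mem_fineSelmerInftyRelaxedInf (ψ : M →+ M')
    (hψ' : ∀ (g : absoluteGaloisGroup K) (m : M), ψ (g • m) = g • ψ m)
    (hψ : ∀ (x : κ.kerSubgroup) (m : M), ψ (ContinuousMonoidHom.id κ.kerSubgroup x • m) = x • ψ m)
    {c : subgroupH1 κ.kerSubgroup M} (hc : c ∈ fineSelmerInftyRelaxedInf M κ) :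
    resH1Hom (ContinuousMonoidHom.id κ.kerSubgroup) ψ hψ c ∈ fineSelmerInftyRelaxedInf M' κ := by
  rw [mem_fineSelmerInftyRelaxedInf_iff_resOfLe] at hc ⊢
  intro v σ
  have hconj : conjH1 κ.kerSubgroup M' σ (resH1Hom (ContinuousMonoidHom.id κ.kerSubgroup) ψ hψ c) =
      resH1Hom (ContinuousMonoidHom.id κ.kerSubgroup) ψ hψ (conjH1 κ.kerSubgroup M σ c) :=
    congrArg (fun f : subgroupH1 κ.kerSubgroup M →+ subgroupH1 κ.kerSubgroup M' ↦ f c)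
      (conjH1_comp_resH1Hom_id κ.kerSubgroup ψ hψ hψ' σ)
  rw [hconj]
  have e := congrArg (fun f : subgroupH1 κ.kerSubgroup M →+
      subgroupH1 (κ.kerSubgroup ⊓ decomp v) M' ↦ f (conjH1 κ.kerSubgroup M σ c))
    (resOfLe_comp_resH1Hom_id (inf_le_left : κ.kerSubgroup ⊓ decomp v ≤ κ.kerSubgroup) ψ hψ
      (fun x m ↦ hψ' x m))
  simp only [AddMonoidHom.comp_apply] at e
  rw [e, hc v σ, map_zero]

variable (W : WeierstrassCurve K)

/-- **`(E[p] ↪ E[p^∞])_*` maps `Sel₀^{rel ∞}(K_∞, E[p])` into `Sel₀^{rel ∞}(K_∞, E[p^∞])`** (the tree's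
`torsionToPrimaryH1Sub` is `resH1Hom id (E[p] ↪ E[p^∞])`). [cite: LimSujatha2018, §3 (the map `R_S(A[π]) → R_S(A)[π]`)] -/
theorem torsionToPrimaryH1Sub_mem_fineSelmerInftyRelaxedInf
    {y : subgroupH1 κ.kerSubgroup (geomTorsion W (p : ℤ))}
    (hy : y ∈ fineSelmerInftyRelaxedInf (↥(geomTorsion W (p : ℤ))) κ) :
    W.torsionToPrimaryH1Sub p κ.kerSubgroup y ∈ W.fineSelmerInftyRelaxedInf κ :=
  resH1Hom_id_mem_fineSelmerInftyRelaxedInf κ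
    (AddSubgroup.inclusion (geomTorsion_le_geomPrimaryTorsion W p)) (fun _ _ ↦ rfl) (fun _ _ ↦ rfl) hy

/-- **`Sel₀^{rel ∞}(K_∞, E[p^∞])[p]` finite ⟹ `Sel₀^{rel ∞}(K_∞, E[p])` finite** (any number field `K`, any elliptic
`W/K`, any prime `p`, any `ℤ_p`-extension `κ`): `Sel₀^{rel ∞}(K_∞, E[p])` lies in the preimage under
`(E[p] ↪ E[p^∞])_*` — FINITE kernel `E(K_∞)[p^∞]/p` (`finite_ker_torsionToPrimaryH1Sub`) — of the `p`-torsion of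
`Sel₀^{rel ∞}(K_∞, E[p^∞])`. (The necessity half of PERFECT-DESCENT (v), relaxed currency, with NO hypothesis on the
rational torsion.) [cite: LimSujatha2018, §3 (proof of Prop. 3.2)] [cite: GreenbergLNM1716, §3 (proof of Lemma 3.1)] -/
theorem finite_fineSelmerInftyRelaxedInf_torsion_of_finite_pTorsion [W.IsElliptic]
    (hfin : Set.Finite {s : W.fineSelmerInftyRelaxedInf κ | p • s = 0}) :
    (fineSelmerInftyRelaxedInf (↥(geomTorsion W (p : ℤ))) κ :
      Set (subgroupH1 κ.kerSubgroup (geomTorsion W (p : ℤ)))).Finite := by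
  set ι := W.torsionToPrimaryH1Sub p κ.kerSubgroup with hι
  set T : Set (W.subgroupH1 p κ.kerSubgroup) :=
    {x | x ∈ W.fineSelmerInftyRelaxedInf κ ∧ p • x = 0} with hT
  have hTfin : T.Finite := by
    have : T = (fun s : W.fineSelmerInftyRelaxedInf κ ↦ (s : W.subgroupH1 p κ.kerSubgroup)) ''
        {s : W.fineSelmerInftyRelaxedInf κ | p • s = 0} := by
      ext x
      simp only [hT, Set.mem_setOf_eq, Set.mem_image]
      constructor
      · rintro ⟨hx, hpx⟩
        exact ⟨⟨x, hx⟩, Subtype.ext (by rw [AddSubgroupClass.coe_nsmul]; exact hpx), rfl⟩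
      · rintro ⟨s, hs, rfl⟩
        exact ⟨s.2, by rw [← AddSubgroupClass.coe_nsmul, hs]; rfl⟩
    rw [this]
    exact hfin.image _
  have hker : ((ι.ker : AddSubgroup (subgroupH1 κ.kerSubgroup (geomTorsion W (p : ℤ)))) :
      Set (subgroupH1 κ.kerSubgroup (geomTorsion W (p : ℤ)))).Finite :=
    W.finite_ker_torsionToPrimaryH1Sub p (H := κ.kerSubgroup) W.zsmul_geomPoints_surjective_holds
  refine (AddMonoidHom.finite_preimage_of_finite_ker ι hker hTfin).subset fun y hy ↦ ?_
  exact ⟨torsionToPrimaryH1Sub_mem_fineSelmerInftyRelaxedInf κ W hy,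
    p_smul_torsionToPrimaryH1Sub_eq_zero W κ.kerSubgroup y⟩

end Criterion

/-! ## §2 The hard half for the CYCLOTOMIC tower, every `p`: `Sel₀^{rel ∞}(K_∞, E[p])` finite ⟹ `Sel₀^{rel ∞}(K_∞, E[p^∞])[p]` finite -/

section Assembly

variable {K : Type} [Field K] [NumberField K] (W : WeierstrassCurve K) [W.IsElliptic] {p : ℕ}
  [Fact p.Prime] (κ : ZpExtension K p)

/-- **`Sel₀^{rel ∞}(K_∞, E[p])` finite ⟹ `Sel₀^{rel ∞}(K_∞, E[p^∞])[p]` finite** for the CYCLOTOMIC `ℤ_p`-extension of a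
number field `K`, an elliptic curve `E = W/K` and ANY prime `p` (also `p = 2`). Proof: the Lim–Sujatha / Greenberg
local analysis of the Literature file `FineSelmerTorsionCoefficientsFiniteProofs`, WITHOUT its archimedean branch —
`R′ = ι⁻¹ Sel₀^{rel ∞}(K_∞, E[p^∞])` has finite image in `∏_{v ∈ S, i < p^c} ker ι_{H ⊓ D_v}` (`S` = bad places ∪ places
above `p`; `p^c` representatives of the finitely many places of `K_∞` above each `v ∈ S`,
`forall_resOfLe_conjH1_eq_zero_of_reps`; local kernels finite, `finite_ker_torsionToPrimaryH1Sub`) with kernel inside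
`Sel₀^{rel ∞}(K_∞, E[p])` (at good `v ∤ p` the local kernels vanish: `E(K_{∞,w})[p^∞]` is `p`-divisible,
`eq_zero_of_torsionToPrimaryH1Sub_eq_zero_of_hasGoodReductionAt`); and `ι` hits every `p`-torsion class. No parity
hypothesis: the relaxed group carries no condition at the infinite places.
[cite: LimSujatha2018, §3 (proof of Prop. 3.2)] [cite: GreenbergLNM1716, §3 (Lemmas 3.1–3.3) and §4 (PDF p. 106)] -/
theorem finite_fineSelmerInftyRelaxedInf_pTorsion_of_finite_torsion (hκ : κ.IsCyclotomic)
    (hfin : (fineSelmerInftyRelaxedInf (↥(W.geomTorsion (p : ℤ))) κ :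
      Set (subgroupH1 κ.kerSubgroup (W.geomTorsion (p : ℤ)))).Finite) :
    Set.Finite {s : W.fineSelmerInftyRelaxedInf κ | p • s = 0} := by
  have hpr : p.Prime := Fact.out
  -- notation
  let H := κ.kerSubgroup
  let Mp : Type := ↥(W.geomTorsion (p : ℤ))
  let ι : subgroupH1 H Mp →+ W.subgroupH1 p H := W.torsionToPrimaryH1Sub p H
  -- the finite set `S` of bad places and places above `p`
  have hSfin : ({v : HeightOneSpectrum (𝓞 K) | (p : 𝓞 K) ∈ v.asIdeal} ∪ W.badPlaces (𝓞 K)).Finite := by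
    refine Set.Finite.union ?_ (W.finite_badPlaces_holds (𝓞 K))
    have hne : Ideal.span {(p : 𝓞 K)} ≠ 0 := by
      rw [Ideal.zero_eq_bot, Ne, Ideal.span_singleton_eq_bot]
      exact_mod_cast hpr.ne_zero
    refine (Ideal.finite_factors hne).subset fun v hv ↦ ?_
    simp only [Set.mem_setOf_eq] at hv ⊢
    exact Ideal.dvd_iff_le.mpr ((Ideal.span_singleton_le_iff_mem _).mpr hv)
  set S := hSfin.toFinset with hSdef
  have hS : ∀ v ∉ S, (p : 𝓞 K) ∉ v.asIdeal ∧ W.HasGoodReductionAt v := by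
    intro v hv
    rw [hSdef, Set.Finite.mem_toFinset, Set.mem_union, not_or] at hv
    refine ⟨hv.1, ?_⟩
    by_contra h
    exact hv.2 h
  -- representatives: a uniform `c` and the elements `τ i`
  have hreps := fun v : HeightOneSpectrum (𝓞 K) ↦
    forall_resOfLe_conjH1_eq_zero_of_reps (M := Mp) hκ v
  choose cv hcv using hreps
  let c : ℕ := S.sup cv
  have hτex : ∀ i : ℕ, ∃ τ : absoluteGaloisGroup K, κ τ = Multiplicative.ofAdd ((i : ℕ) : ℤ_[p]) :=
    fun i ↦ κ.surjective _
  choose τ hτ using hτex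
  -- the signature map `Ψ` (finite places of `S` only)
  let resv : ∀ v : HeightOneSpectrum (𝓞 K), subgroupH1 H Mp →+ subgroupH1 (H ⊓ decomp v) Mp := fun v ↦
    resOfLe Mp (inf_le_left : H ⊓ decomp v ≤ H)
  let Ψ : subgroupH1 H Mp →+ ((v : S) → Fin (p ^ c) → subgroupH1 (H ⊓ decomp (v : HeightOneSpectrum (𝓞 K))) Mp) :=
    { toFun := fun x v i ↦ resv v (conjH1 H Mp (τ i) x)
      map_zero' := by ext v i; simp
      map_add' := fun x y ↦ by ext v i; simp }
  -- `R′ = ι⁻¹ Sel₀^{rel ∞}(K_∞, E[p^∞])`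
  let R' : AddSubgroup (subgroupH1 H Mp) := (W.fineSelmerInftyRelaxedInf κ).comap ι
  have hR'mem : ∀ x : subgroupH1 H Mp, x ∈ R' ↔ ι x ∈ W.fineSelmerInftyRelaxedInf κ := fun x ↦ Iff.rfl
  -- (a) values of `Ψ` on `R′` lie in the finite local kernels
  have hΨker : ∀ x ∈ R', ∀ (v : S) (i : Fin (p ^ c)),
      Ψ x v i ∈ (W.torsionToPrimaryH1Sub p (H ⊓ decomp (v : HeightOneSpectrum (𝓞 K)))).ker := by
    intro x hx v i
    rw [AddMonoidHom.mem_ker]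
    change W.torsionToPrimaryH1Sub p _ (resv v (conjH1 H Mp (τ i) x)) = 0
    rw [← resOfLe_torsionToPrimaryH1Sub, ← WeierstrassCurve.conjH1_torsionToPrimaryH1Sub]
    exact (mem_fineSelmerInftyRelaxedInf_iff_resOfLe κ _).mp ((hR'mem x).mp hx) v (τ i)
  -- (b) the kernel of `Ψ` on `R′` is contained in `Sel₀^{rel ∞}(K_∞, E[p])`
  have hΨzero : ∀ x ∈ R', Ψ x = 0 → x ∈ fineSelmerInftyRelaxedInf Mp κ := by
    intro x hx hΨ
    have hxS : ι x ∈ W.fineSelmerInftyRelaxedInf κ := (hR'mem x).mp hx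
    have hxS' := (mem_fineSelmerInftyRelaxedInf_iff_resOfLe κ _).mp hxS
    rw [mem_fineSelmerInftyRelaxedInf_iff_resOfLe]
    intro v σ
    by_cases hvS : v ∈ S
    · -- representatives
      refine hcv v τ hτ x (fun i hi ↦ ?_) σ
      have hi' : i < p ^ c := lt_of_lt_of_le hi (Nat.pow_le_pow_right hpr.pos (Finset.le_sup hvS))
      have := congrFun (congrFun hΨ ⟨v, hvS⟩) ⟨i, hi'⟩
      exact this
    · -- good place `v ∤ p`: the local kernel vanishes
      obtain ⟨hpv, hgood⟩ := hS v hvS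
      refine eq_zero_of_torsionToPrimaryH1Sub_eq_zero_of_hasGoodReductionAt W κ hκ hpv hgood _ ?_
      rw [← resOfLe_torsionToPrimaryH1Sub, ← WeierstrassCurve.conjH1_torsionToPrimaryH1Sub]
      exact hxS' v σ
  -- (c) `R′` is finite
  have hR'fin : (R' : Set (subgroupH1 H Mp)).Finite := by
    let g : R' →+ ((v : S) → Fin (p ^ c) → subgroupH1 (H ⊓ decomp (v : HeightOneSpectrum (𝓞 K))) Mp) :=
      Ψ.comp R'.subtype
    have hgker : ((g.ker : AddSubgroup R') : Set R').Finite := by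
      have hsub : ((g.ker : AddSubgroup R') : Set R') ⊆
          (fun r : R' ↦ (r : subgroupH1 H Mp)) ⁻¹'
            (fineSelmerInftyRelaxedInf Mp κ : Set (subgroupH1 H Mp)) := by
        intro r hr
        exact hΨzero r r.2 ((AddMonoidHom.mem_ker).mp hr)
      exact (hfin.preimage Subtype.val_injective.injOn).subset hsub
    let T : Set ((v : S) → Fin (p ^ c) → subgroupH1 (H ⊓ decomp (v : HeightOneSpectrum (𝓞 K))) Mp) :=
      Set.pi Set.univ fun v ↦ Set.pi Set.univ fun _ ↦
        ((W.torsionToPrimaryH1Sub p (H ⊓ decomp (v : HeightOneSpectrum (𝓞 K)))).ker : Set _)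
    have hTfin : T.Finite := by
      refine Set.Finite.pi fun v ↦ Set.Finite.pi fun _ ↦ ?_
      exact W.finite_ker_torsionToPrimaryH1Sub p (H := H ⊓ decomp (v : HeightOneSpectrum (𝓞 K)))
        W.zsmul_geomPoints_surjective_holds
    have huniv : (g ⁻¹' T) = Set.univ := by
      ext r
      simp only [Set.mem_preimage, Set.mem_univ, iff_true, T, Set.mem_univ_pi]
      intro v i
      exact hΨker r r.2 v i
    have hR'univ : (Set.univ : Set R').Finite := by
      rw [← huniv]
      exact AddMonoidHom.finite_preimage_of_finite_ker g hgker hTfin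
    have : (R' : Set (subgroupH1 H Mp)) = (fun r : R' ↦ (r : subgroupH1 H Mp)) '' Set.univ := by
      ext x
      simp only [SetLike.mem_coe, Set.image_univ, Set.mem_range, Subtype.exists, exists_prop,
        exists_eq_right]
    rw [this]
    exact hR'univ.image _
  -- (d) every `p`-torsion class of `Sel₀^{rel ∞}(K_∞, E[p^∞])` is `ι x` with `x ∈ R′`
  have hsub : {s : W.fineSelmerInftyRelaxedInf κ | p • s = 0} ⊆
      (fun s : W.fineSelmerInftyRelaxedInf κ ↦ (s : W.subgroupH1 p H)) ⁻¹'
        (ι '' (R' : Set (subgroupH1 H Mp))) := by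
    intro s hs
    have hs' : p • (s : W.subgroupH1 p H) = 0 := by
      rw [← AddSubgroupClass.coe_nsmul, show p • s = 0 from hs]; rfl
    obtain ⟨x, hx⟩ := W.exists_torsionToPrimaryH1Sub_eq p W.zsmul_geomPoints_surjective_holds hs'
    refine ⟨x, ?_, hx⟩
    change ι x ∈ W.fineSelmerInftyRelaxedInf κ
    rw [show ι x = (s : W.subgroupH1 p H) from hx]
    exact s.2
  exact ((hR'fin.image ι).preimage Subtype.val_injective.injOn).subset hsub

/-- **PERFECT DESCENT (v), relaxed currency, as an EQUIVALENCE**: for the cyclotomic `ℤ_p`-extension of a number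
field and an elliptic curve, `Sel₀^{rel ∞}(K_∞, E[p^∞])[p]` is finite iff `Sel₀^{rel ∞}(K_∞, E[p])` is finite —
every `p`, no hypothesis on the reduction or the torsion (statement (A)ₚ^{rel ∞} read on the `p`-torsion module).
[cite: LimSujatha2018, §3 (proof of Prop. 3.2: "`R(A[π]/F^cyc)` finite ⟺ `Y(A/F^cyc)` f.g.")] [cite: GreenbergLNM1716, §3] -/
theorem finite_fineSelmerInftyRelaxedInf_pTorsion_iff (hκ : κ.IsCyclotomic) :
    Set.Finite {s : W.fineSelmerInftyRelaxedInf κ | p • s = 0} ↔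
      (fineSelmerInftyRelaxedInf (↥(W.geomTorsion (p : ℤ))) κ :
        Set (subgroupH1 κ.kerSubgroup (W.geomTorsion (p : ℤ)))).Finite :=
  ⟨finite_fineSelmerInftyRelaxedInf_torsion_of_finite_pTorsion κ W,
    finite_fineSelmerInftyRelaxedInf_pTorsion_of_finite_torsion W κ hκ⟩

omit [W.IsElliptic] in
/-- Bookkeeping: if every archimedean condition on `H¹(K_∞, E[p])` is vacuous (`infKer = ⊤` at every infinite place —
e.g. `p` odd, or `K` totally complex, or `K = ℚ`, `p = 2`, `Δ_E < 0`), then `Sel₀^{rel ∞}(K_∞, E[p]) = Sel₀(K_∞, E[p])`.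
[cite: GreenbergLNM1716, §4, before Lemma 4.6 (PDF p. 106)] -/
theorem fineSelmerInftyRelaxedInf_torsion_eq_of_infKer_eq_top
    (h : ∀ w : InfinitePlace K, infKer κ.kerSubgroup (↥(W.geomTorsion (p : ℤ))) w = ⊤) :
    fineSelmerInftyRelaxedInf (↥(W.geomTorsion (p : ℤ))) κ = fineSelmerInfty (↥(W.geomTorsion (p : ℤ))) κ :=
  strictSelmerGroupOverRelaxedInf_eq_of_infKer_eq_top κ.kerSubgroup _ p _ h

/-- **The STRICT form, whenever the archimedean local cohomology of `E[p]` over `K_∞` vanishes**: for the cyclotomic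
`ℤ_p`-extension and ANY `p`, if `infKer H¹(K_∞, E[p]) = ⊤` at every infinite place then `Sel₀(K_∞, E[p])` finite ⟹
`Sel₀(K_∞, E[p^∞])[p]` finite (`Sel₀ ≤ Sel₀^{rel ∞}` on the `E[p^∞]` side, equality on the `E[p]` side). Recovers the
Literature's `finite_fineSelmerInfty_pTorsion_of_finite_torsion` (odd `p`: groups of order `≤ 2`) and covers
`(ℚ, 2, Δ_E < 0)` (sibling `…RelaxedCoefficientsRatTwo`). It does NOT cover `(ℚ, 2, Δ_E > 0)`: there the archimedean local kernels `E(ℝ)[2^∞]/2 ≅ ℤ/2`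
at the `2ⁿ` real places of `ℚ_n` are genuine. [cite: LimSujatha2018, §3 (proof of Prop. 3.2)] [cite: GreenbergLNM1716, §4 Lemma 4.6 and PDF pp. 106–107] -/
theorem finite_fineSelmerInfty_pTorsion_of_finite_torsion_of_infKer_eq_top (hκ : κ.IsCyclotomic)
    (h : ∀ w : InfinitePlace K, infKer κ.kerSubgroup (↥(W.geomTorsion (p : ℤ))) w = ⊤)
    (hfin : (fineSelmerInfty (↥(W.geomTorsion (p : ℤ))) κ :
      Set (subgroupH1 κ.kerSubgroup (W.geomTorsion (p : ℤ)))).Finite) :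
    Set.Finite {s : W.fineSelmerInfty κ | p • s = 0} := by
  have hrel : Set.Finite {s : W.fineSelmerInftyRelaxedInf κ | p • s = 0} := by
    refine finite_fineSelmerInftyRelaxedInf_pTorsion_of_finite_torsion W κ hκ ?_
    rw [fineSelmerInftyRelaxedInf_torsion_eq_of_infKer_eq_top W κ h]
    exact hfin
  -- transport along the inclusion `Sel₀ ≤ Sel₀^{rel ∞}`
  let j : W.fineSelmerInfty κ → W.fineSelmerInftyRelaxedInf κ :=
    fun s ↦ AddSubgroup.inclusion (W.fineSelmerInfty_le_fineSelmerInftyRelaxedInf κ) s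
  have hj : Function.Injective j := AddSubgroup.inclusion_injective _
  refine (hrel.preimage hj.injOn).subset fun s hs ↦ ?_
  simp only [Set.mem_preimage, Set.mem_setOf_eq] at hs ⊢
  rw [← map_nsmul, hs, map_zero]

end Assembly

end Summit.BirchSwinnertonDyer.BirchSwinnertonDyer.Theorems.AlignedTransportAtTwoFineRoad.RelaxedCoefficients

end
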